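import Summits.SmoothPoincare4.SmoothPoincare4.Theorems.CylinderEntropyCylinderRungTwoZonalMassAndFirstMoment
import Summits.SmoothPoincare4.SmoothPoincare4.Theorems.CylinderEntropyCylinderRungTwoAtomicQuantization
import Literature.Geometry.Riemannian.SphericalCylinderEntropy
import Literature.Geometry.Riemannian.SphericalZonalKernelSeriesDeriv
import Mathlib.MeasureTheory.Integral.DominatedConvergence
import HarnessLib

/-!
# Route `CylinderEntropy`, crux `CylinderRungTwo` (stmt-SmoothPoincare4-7631), line `killing-flux`:
# the typed kernel against a product measure, and the small-scale limit of the vertical Gaussian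
# mass (registered helpers `helper_kernelMassOfProduct`, `helper_verticalGaussianMassTendsto`;
# lead c4, "relaxation up to multiplicity", worker K1)

Weak limits `μ` of the area measures of thin cylinder flows are finite measures on `ℝ⁶` carried by
the round cylinder `N = S⁴ × ℝ = {z | ∑_{i<5} zᵢ² = 1}` with PRODUCT structure: against products of
continuous test functions `Φ(z₅) g(z')` (`z' = truncL z ∈ ℝ⁵` the first five coordinates) they are
uniform in the `S⁴` factor,

  `∫ Φ(z₅) g(z') dμ = μH⁴(S⁴)⁻¹ (∫_{S⁴} g dμH⁴) ∫ Φ(z₅) dμ`.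

* `helper_kernelMassOfProduct`.  For such `μ`, a centre `y ∈ N` and a scale `τ > 0`, the typed
  slice-normalised backward heat kernel `K_{y,τ}(z) = 𝔥(τ, ⟨z', y'⟩) e^{-(z₅ - y₅)²/4τ}`
  (`SphericalCylinderEntropy.cylKernel`, `cylKernel_eq`) integrates through its vertical factor only:
  `∫ K_{y,τ} dμ = ∫ e^{-(z₅ - y₅)²/4τ} dμ(z)`.  Indeed `K_{y,τ}(z) = Φ(z₅) g(z')` with
  `Φ(h) = e^{-(h - y₅)²/4τ}` and `g(q) = 𝔥(τ, ⟨q, y'⟩)` (both continuous: the zonal series is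
  continuous, `SphericalZonalKernelSeries.continuous_zonal`), and the `S⁴`-average of `g` is exactly
  `1` by the ZONAL MASS identity `∫_{S⁴} 𝔥(τ, ⟨y', ·⟩) dμH⁴ = μH⁴(S⁴)`
  (`helper_zonalMassAndFirstMoment`).  The carrier hypothesis `μ(ℝ⁶ ∖ N) = 0` of the registered
  signature is not used.
* `helper_verticalGaussianMassTendsto`.  For every finite measure `μ` on `ℝ⁶` and every height `c`,
  `∫ e^{-(z₅ - c)²/4τ} dμ(z) → μ{z | z₅ = c}` as `τ → 0⁺`: dominated convergence (bound `1`,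
  integrable since `μ` is finite; for `τ > 0` the integrand is `≤ 1`), the integrand tending pointwise
  to the indicator of the slice `{z₅ = c}` (constantly `1` on it, and `e^{-a/4τ} → 0` for `a > 0`);
  the slice is measurable by the landed `AtomicQuantization.measurableSet_slice`.

Everything here is PROVED (no `sorry`, no definitions, no named facts).

References: H. Federer, *Geometric Measure Theory* (1969), 2.10.45 (product measures);
C. Müller, *Spherical Harmonics*, LNM 17 (1966), §4 (Funk–Hecke: the zonal mass).
-/

-- the prescribed namespace `Summit.SmoothPoincare4.SmoothPoincare4.…` repeats `SmoothPoincare4`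
set_option linter.dupNamespace false

noncomputable section

open Bundle Set Function Filter MeasureTheory Module
open scoped Manifold ContDiff Topology RealInnerProductSpace BigOperators ENNReal NNReal

namespace Summit.SmoothPoincare4.SmoothPoincare4.Cruxes.CylinderRungTwo.KillingFlux

open Literature.Geometry.Riemannian
open Literature.Geometry.Riemannian.SphericalCylinderEntropy (cylKernel zonal truncL truncL_apply
  cylKernel_eq hausdorffMeasure_sphere_four_pos hausdorffMeasure_sphere_four_lt_top)
open Literature.Geometry.Riemannian.SphericalZonalKernelSeries (continuous_zonal)

namespace KernelMassOfProduct

/-! ## The two factors of the typed kernel -/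

/-- The vertical Gaussian factor `h ↦ e^{-(h - b)²/4τ}` is continuous. [folklore] -/
theorem continuous_verticalGaussian (b τ : ℝ) :
    Continuous fun h : ℝ => Real.exp (-((h - b) ^ 2) / (4 * τ)) := by
  fun_prop

/-- The vertical Gaussian factor `z ↦ e^{-(z₅ - b)²/4τ}` is continuous on `ℝ⁶`. [folklore] -/
theorem continuous_verticalGaussian_comp (b τ : ℝ) :
    Continuous fun z : EuclideanSpace ℝ (Fin 6) => Real.exp (-((z 5 - b) ^ 2) / (4 * τ)) := by
  fun_prop

/-- The horizontal zonal factor `q ↦ 𝔥(τ, ⟨q, x⟩)` is continuous on `ℝ⁵` for `τ > 0` (the zonal heat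
series is continuous on `ℝ`). [folklore] -/
theorem continuous_zonal_sum_mul {τ : ℝ} (hτ : 0 < τ) (x : EuclideanSpace ℝ (Fin 5)) :
    Continuous fun q : EuclideanSpace ℝ (Fin 5) => zonal τ (∑ i : Fin 5, x i * q i) :=
  (continuous_zonal hτ).comp (by fun_prop)

/-- The typed kernel factors as (vertical Gaussian at `z₅`) × (zonal factor at `truncL z`):
`K_{y,τ}(z) = e^{-(z₅ - y₅)²/4τ} 𝔥(τ, ⟨y', z'⟩)` with `y' = truncL y`, `z' = truncL z`. [folklore] -/
theorem cylKernel_eq_vertical_mul_zonal (y : EuclideanSpace ℝ (Fin 6)) (τ : ℝ)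
    (z : EuclideanSpace ℝ (Fin 6)) :
    cylKernel y τ z = Real.exp (-((z 5 - y 5) ^ 2) / (4 * τ)) *
      zonal τ (∑ i : Fin 5, truncL y i * truncL z i) := by
  rw [cylKernel_eq, mul_comm (zonal τ _) _]
  congr 2
  exact Finset.sum_congr rfl fun i _ => by rw [truncL_apply, truncL_apply, mul_comm]

/-- A centre `y ∈ N` has a unit horizontal part `truncL y ∈ S⁴`. [folklore] -/
theorem sum_truncL_sq_eq_one {y : EuclideanSpace ℝ (Fin 6)}
    (hy : ∑ i : Fin 5, y (Fin.castSucc i) ^ 2 = 1) : ∑ i : Fin 5, truncL y i ^ 2 = 1 := by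
  simpa only [truncL_apply] using hy

/-- The normalising constant `μH⁴(S⁴)` is a non-zero real. [folklore] -/
theorem toReal_hausdorffMeasure_sphere_four_ne_zero :
    (μH[4] (Metric.sphere (0 : EuclideanSpace ℝ (Fin 5)) 1)).toReal ≠ 0 :=
  (ENNReal.toReal_pos hausdorffMeasure_sphere_four_pos.ne' hausdorffMeasure_sphere_four_lt_top.ne).ne'

/-! ## The vertical Gaussian: bound and pointwise limit -/

/-- For `τ > 0` the vertical Gaussian is bounded by `1`: `‖e^{-(h - c)²/4τ}‖ ≤ 1`. [folklore] -/
theorem norm_verticalGaussian_le_one {τ : ℝ} (hτ : 0 < τ) (h c : ℝ) :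
    ‖Real.exp (-((h - c) ^ 2) / (4 * τ))‖ ≤ 1 := by
  rw [Real.norm_eq_abs, Real.abs_exp, Real.exp_le_one_iff]
  exact div_nonpos_of_nonpos_of_nonneg (neg_nonpos.2 (sq_nonneg _)) (by positivity)

/-- Off the slice the vertical Gaussian dies: for `h ≠ c`, `e^{-(h - c)²/4τ} → 0` as `τ → 0⁺`.
[folklore] -/
theorem tendsto_verticalGaussian_of_ne {h c : ℝ} (hne : h ≠ c) :
    Tendsto (fun τ : ℝ => Real.exp (-((h - c) ^ 2) / (4 * τ))) (𝓝[>] 0) (𝓝 0) := by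
  have hpos : 0 < (h - c) ^ 2 := by positivity [sub_ne_zero.2 hne]
  have h1 : Tendsto (fun τ : ℝ => -((h - c) ^ 2) / 4 * τ⁻¹) (𝓝[>] 0) atBot :=
    tendsto_inv_nhdsGT_zero.const_mul_atTop_of_neg (by linarith)
  have h2 : Tendsto (fun τ : ℝ => -((h - c) ^ 2) / (4 * τ)) (𝓝[>] 0) atBot := by
    refine h1.congr fun τ => ?_
    ring
  exact Real.tendsto_exp_atBot.comp h2

/-- The pointwise limit of the vertical Gaussian is the indicator of the slice `{z₅ = c}`. [folklore] -/
theorem tendsto_verticalGaussian_indicator (c : ℝ) (z : EuclideanSpace ℝ (Fin 6)) :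
    Tendsto (fun τ : ℝ => Real.exp (-((z 5 - c) ^ 2) / (4 * τ))) (𝓝[>] 0)
      (𝓝 (Set.indicator {z : EuclideanSpace ℝ (Fin 6) | z 5 = c} 1 z)) := by
  by_cases hz : z 5 = c
  · have hmem : z ∈ {z : EuclideanSpace ℝ (Fin 6) | z 5 = c} := hz
    rw [Set.indicator_of_mem hmem, Pi.one_apply]
    have hconst : (fun τ : ℝ => Real.exp (-((z 5 - c) ^ 2) / (4 * τ))) = fun _ => 1 := by
      funext τ
      rw [hz, sub_self, zero_pow two_ne_zero, neg_zero, zero_div, Real.exp_zero]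
    rw [hconst]
    exact tendsto_const_nhds
  · have hnmem : z ∉ {z : EuclideanSpace ℝ (Fin 6) | z 5 = c} := hz
    rw [Set.indicator_of_notMem hnmem]
    exact tendsto_verticalGaussian_of_ne hz

end KernelMassOfProduct

open KernelMassOfProduct
open AtomicQuantization (measurableSet_slice)

/-- **Registered helper `helper_kernelMassOfProduct` of line `killing-flux` (lead c4, relaxation up to
multiplicity, K1-A).**  For a finite measure `μ` on `ℝ⁶` which is uniform in the `S⁴` factor against
continuous product tests, a centre `y ∈ N` and a scale `τ > 0`, the typed kernel integrates through its
vertical factor only: `∫ K_{y,τ} dμ = ∫ e^{-(z₅ - y₅)²/4τ} dμ(z)` (factor `K_{y,τ}(z) = Φ(z₅) g(z')`,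
apply the product hypothesis, and the `S⁴`-average of `g = 𝔥(τ, ⟨·, y'⟩)` is `1` by the zonal mass
identity `helper_zonalMassAndFirstMoment`).  The carrier hypothesis is not used. [folklore] -/
theorem helper_kernelMassOfProduct : ∀ (μ : Measure (EuclideanSpace ℝ (Fin 6))) [IsFiniteMeasure μ], μ {z : EuclideanSpace ℝ (Fin 6) | ¬ (∑ i : Fin 5, z (Fin.castSucc i) ^ 2 = 1)} = 0 → (∀ Φ : ℝ → ℝ, Continuous Φ → ∀ g : EuclideanSpace ℝ (Fin 5) → ℝ, Continuous g → ∫ z, Φ (z 5) * g (Literature.Geometry.Riemannian.SphericalCylinderEntropy.truncL z) ∂μ = ((μH[4] (Metric.sphere (0 : EuclideanSpace ℝ (Fin 5)) 1)).toReal)⁻¹ * (∫ y in Metric.sphere (0 : EuclideanSpace ℝ (Fin 5)) 1, g y ∂(μH[4] : Measure (EuclideanSpace ℝ (Fin 5)))) * ∫ z, Φ (z 5) ∂μ) → ∀ y : EuclideanSpace ℝ (Fin 6), ∑ i : Fin 5, y (Fin.castSucc i) ^ 2 = 1 → ∀ τ : ℝ, 0 < τ → ∫ z, Literature.Geometry.Riemannian.SphericalCylinderEntropy.cylKernel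 y τ z ∂μ = ∫ z, Real.exp (-((z 5 - y 5) ^ 2) / (4 * τ)) ∂μ := by
  intro μ _ _ hprod y hy τ hτ
  obtain ⟨hmass, -⟩ := helper_zonalMassAndFirstMoment τ hτ (truncL y) (sum_truncL_sq_eq_one hy)
  have h := hprod _ (continuous_verticalGaussian (y 5) τ) _ (continuous_zonal_sum_mul hτ (truncL y))
  rw [hmass, inv_mul_cancel₀ toReal_hausdorffMeasure_sphere_four_ne_zero, one_mul] at h
  rw [← h]
  exact integral_congr_ae (Eventually.of_forall fun z => cylKernel_eq_vertical_mul_zonal y τ z)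

/-- **Registered helper `helper_verticalGaussianMassTendsto` of line `killing-flux` (lead c4, relaxation
up to multiplicity, K1-B).**  For a finite measure `μ` on `ℝ⁶` and a height `c`, the vertical Gaussian
mass tends to the mass of the slice: `∫ e^{-(z₅ - c)²/4τ} dμ(z) → μ{z₅ = c}` as `τ → 0⁺` (dominated
convergence with bound `1`; the integrand tends pointwise to the indicator of the slice). [folklore] -/
theorem helper_verticalGaussianMassTendsto : ∀ (μ : Measure (EuclideanSpace ℝ (Fin 6))) [IsFiniteMeasure μ] (c : ℝ), Filter.Tendsto (fun τ : ℝ => ∫ z, Real.exp (-((z 5 - c) ^ 2) / (4 * τ)) ∂μ) (𝓝[>] 0) (𝓝 (μ.real {z : EuclideanSpace ℝ (Fin 6) | z 5 = c})) := by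
  intro μ _ c
  rw [← integral_indicator_one (measurableSet_slice c)]
  refine tendsto_integral_filter_of_dominated_convergence (fun _ => (1 : ℝ))
    (Eventually.of_forall fun τ => (continuous_verticalGaussian_comp c τ).aestronglyMeasurable)
    (eventually_nhdsWithin_of_forall fun τ hτ => ae_of_all _ fun z =>
      norm_verticalGaussian_le_one hτ (z 5) c)
    (integrable_const _) (ae_of_all _ fun z => tendsto_verticalGaussian_indicator c z)

end Summit.SmoothPoincare4.SmoothPoincare4.Cruxes.CylinderRungTwo.KillingFlux

end
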